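import Literature.NumberTheory.NumberFields.CubicFieldIntegers
import Mathlib.LinearAlgebra.Matrix.Nondegenerate
import Mathlib.RingTheory.IntegralClosure.IntegrallyClosed
import Mathlib.RingTheory.Norm.Basic
import Mathlib.RingTheory.Trace.Basic
import HarnessLib

/-!
# Rank-2 observatory — index-`1` certificates for monic cubics at the square primes of `Δ`

HONEST FRAMING: per-curve certified theorems and census instruments; no claim on BSD in
rank ≥ 2.  (cert-2 = the rank-3 arm; this file is a GENERIC number-field helper.)

The kernel 2-descent field files (`Rank2ObservatoryCubicField<Tag>.lean`,
`Rank2ObservatoryCubicFieldCl<Tag>.lean`) need `𝓞 K = ℤ[α]`, i.e.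
`RingOfIntegers.exponent α = 1`, for the cubic 2-division field `K = ℚ(α)`,
`α³ + aα² + bα + c = 0`.  So far this was available only through the square-factor condition on
`Δ(g)` (`MonicCubic.exponent_thetaInt`: `Δ = r²e`, `|e| > 2 ⇒ r = ±1`), which fails as soon as
`p² ∣ Δ(g)` although `ℤ[α] = 𝓞 K` (e.g. `Δ = -244 = -4·61`).  Here the index is certified by a
FINITE KERNEL CHECK instead (Marcus, *Number Fields*, Ch. 2, Exercise 27 and Thm. 4; the
classical "no new integral element `(u + vα + wα²)/p`" test):

* `exists_smul_eq_of_prime_dvd_indexDet` (any number field, any integral power basis): if a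
  prime `p` divides the index determinant `indexDet` (the tree's
  `Literature.NumberTheory.NumberFields.indexDet`), then some `ℤ`-combination
  `∑ cⱼ θʲ` with `0 ≤ cⱼ < p`, not all `0`, is `p · y` with `y ∈ 𝓞 K` (a kernel vector of the
  change-of-basis matrix modulo `p`);
* `Passes a b c p u v w` / `NoNewIntegralAt a b c p` (DECIDABLE): seven necessary conditions
  for `y = (u + vα + wα²)/p ∈ 𝓞 K` — the traces of `y, αy, α²y` and the norms of
  `y, y+1, y+2, y+α` are integers — written with the explicit trace and norm forms of
  `Literature.NumberTheory.NumberFields.MonicCubic` (`trace_lin`, `norm_lin`);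
  `passes_of_eq_smul` proves they are indeed necessary;
* `isUnit_indexDet_of_check`, `exponent_thetaInt_eq_one_of_check`, `discr_eq_disc_of_check`:
  if `Δ(g) = r² e` with `e` squarefree and `NoNewIntegralAt a b c p` holds (by `decide`) for
  every prime `p ∣ r`, then `indexDet = ±1`, `𝓞 K = ℤ[α]` (`exponent = 1`) and `d_K = Δ(g)`.

Used by the cut-2 field files of the class-group-general kernel 2-descent (even class number,
`p² ∣ disc`); everything here is proved, no new axioms.

References: [cite: Marcus2018, Ch. 2, Exercise 27; Ch. 2, Thm. 4] D. A. Marcus, *Number Fields*,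
2nd ed. (2018).
-/

set_option linter.dupNamespace false

noncomputable section

open Polynomial Module NumberField Matrix
open scoped NumberField

namespace Summit.BirchSwinnertonDyer.BirchSwinnertonDyer.Rank2Observatory.CubicIndexCheck

open Literature.NumberTheory.NumberFields Literature.NumberTheory.NumberFields.MonicCubic

/-! ### A prime dividing the index determinant produces a new `p`-integral combination -/

section Generic

variable {K : Type*} [Field K] [NumberField K]

/-- **Kernel vector modulo `p`.** If a prime `p` divides `indexDet B` (the determinant of the
integer matrix expressing `1, θ, …, θⁿ⁻¹` in an integral basis), then there are
`0 ≤ cⱼ < p`, not all zero, and `y ∈ 𝓞 K` with `∑ⱼ cⱼ θʲ = p · y`.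
[cite: Marcus2018, Ch. 2, Exercise 27(d)] -/
theorem exists_smul_eq_of_prime_dvd_indexDet (B : PowerBasis ℚ K) (hint : IsIntegral ℤ B.gen)
    {p : ℕ} (hp : p.Prime) (hdvd : (p : ℤ) ∣ indexDet B hint) :
    ∃ c : Fin B.dim → ℕ, (∀ j, c j < p) ∧ (∃ j, c j ≠ 0) ∧
      ∃ y : 𝓞 K, ∑ j, ((c j : ℕ) : ℤ) • powInt B hint j = (p : ℤ) • y := by
  classical
  haveI : Fact p.Prime := ⟨hp⟩
  set M : Matrix (Fin B.dim) (Fin B.dim) ℤ := (intBasis B).toMatrix (powInt B hint) with hM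
  have hdet : indexDet B hint = M.det := by rw [indexDet, Basis.det_apply]
  set Mp : Matrix (Fin B.dim) (Fin B.dim) (ZMod p) := M.map (Int.castRingHom (ZMod p)) with hMp
  have hdet0 : Mp.det = 0 := by
    rw [hMp, ← RingHom.mapMatrix_apply, ← RingHom.map_det, ← hdet]
    exact (ZMod.intCast_zmod_eq_zero_iff_dvd _ p).mpr hdvd
  obtain ⟨v, hv0, hMv⟩ := Matrix.exists_mulVec_eq_zero_iff.mpr hdet0
  refine ⟨fun j => (v j).val, fun j => (v j).val_lt, ?_, ?_⟩
  · by_contra h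
    exact hv0 (funext fun j => (ZMod.val_eq_zero (v j)).mp (by by_contra hj; exact h ⟨j, hj⟩))
  · have hrow : ∀ i, (p : ℤ) ∣ ∑ j, M i j * (((v j).val : ℕ) : ℤ) := by
      intro i
      have h := congr_fun hMv i
      rw [Matrix.mulVec, dotProduct, Pi.zero_apply] at h
      refine (ZMod.intCast_zmod_eq_zero_iff_dvd _ p).mp ?_
      push_cast
      simp only [ZMod.natCast_val, ZMod.cast_id', id_eq]
      simpa [hMp, Matrix.map_apply] using h
    choose k hk using hrow
    refine ⟨∑ i, k i • intBasis B i, ?_⟩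
    have hcol : ∀ j, powInt B hint j = ∑ i, M i j • intBasis B i := by
      intro j
      conv_lhs => rw [← (intBasis B).sum_repr (powInt B hint j)]
      simp [hM, Basis.toMatrix_apply]
    calc ∑ j, (((v j).val : ℕ) : ℤ) • powInt B hint j
        = ∑ j, (((v j).val : ℕ) : ℤ) • ∑ i, M i j • intBasis B i := by
          refine Finset.sum_congr rfl fun j _ => ?_
          rw [← hcol j]
      _ = ∑ i, (∑ j, M i j * (((v j).val : ℕ) : ℤ)) • intBasis B i := by
          simp_rw [Finset.smul_sum, smul_smul]
          rw [Finset.sum_comm]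
          refine Finset.sum_congr rfl fun i _ => ?_
          rw [Finset.sum_smul]
          refine Finset.sum_congr rfl fun j _ => ?_
          rw [mul_comm]
      _ = ∑ i, ((p : ℤ) * k i) • intBasis B i := by
          refine Finset.sum_congr rfl fun i _ => ?_
          rw [hk i]
      _ = (p : ℤ) • ∑ i, k i • intBasis B i := by
          rw [Finset.smul_sum]
          refine Finset.sum_congr rfl fun i _ => ?_
          rw [smul_smul]

end Generic

/-! ### The decidable "no new integral element at `p`" test for a monic cubic -/

/-- The trace form `Tr(u + vα + wα²) = 3u - av + (a² - 2b)w` over `ℤ`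
(`MonicCubic.trace_lin`). [cite: Marcus2018, Ch. 2, Thm. 4] -/
def trZ (a b : ℤ) (u v w : ℤ) : ℤ := 3 * u - a * v + (a ^ 2 - 2 * b) * w

/-- The norm form `N(u + vα + wα²)` over `ℤ` (`MonicCubic.normForm`). [cite: Marcus2018, Ch. 2, Thm. 4] -/
def nmZ (a b c : ℤ) (u v w : ℤ) : ℤ :=
  u ^ 3 - a * u ^ 2 * v + (a ^ 2 - 2 * b) * u ^ 2 * w + b * u * v ^ 2 +
    (3 * c - a * b) * u * v * w + (b ^ 2 - 2 * a * c) * u * w ^ 2 - c * v ^ 3 +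
    a * c * v ^ 2 * w - b * c * v * w ^ 2 + c ^ 2 * w ^ 3

/-- Seven NECESSARY conditions for `(u + vα + wα²)/p ∈ 𝓞 K`: the traces of `y`, `αy`, `α²y`
are integers and the norms of `y`, `y + 1`, `y + 2`, `y + α` are integers
(`α·(u + vα + wα²) = -cw + (u - bw)α + (v - aw)α²`). [cite: Marcus2018, Ch. 2, Thm. 4] -/
def Passes (a b c : ℤ) (p : ℕ) (u v w : ℤ) : Prop :=
  (p : ℤ) ∣ trZ a b u v w ∧
  (p : ℤ) ∣ trZ a b (-c * w) (u - b * w) (v - a * w) ∧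
  (p : ℤ) ∣ trZ a b (-c * (v - a * w)) (-c * w - b * (v - a * w)) ((u - b * w) - a * (v - a * w)) ∧
  (p : ℤ) ^ 3 ∣ nmZ a b c u v w ∧
  (p : ℤ) ^ 3 ∣ nmZ a b c (u + p) v w ∧
  (p : ℤ) ^ 3 ∣ nmZ a b c (u + 2 * p) v w ∧
  (p : ℤ) ^ 3 ∣ nmZ a b c u (v + p) w

/-- `Passes` is decidable (integer divisibilities). [folklore] -/
instance (a b c : ℤ) (p : ℕ) (u v w : ℤ) : Decidable (Passes a b c p u v w) := by
  unfold Passes; infer_instance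

/-- **No new integral element at `p`:** no `(u, v, w) ∈ [0, p)³ ∖ {0}` passes the seven tests —
so no `(u + vα + wα²)/p` is an algebraic integer.  Decidable; discharged by `decide` per field.
[cite: Marcus2018, Ch. 2, Exercise 27] -/
def NoNewIntegralAt (a b c : ℤ) (p : ℕ) : Prop :=
  ∀ u v w : Fin p, ((u : ℕ) ≠ 0 ∨ (v : ℕ) ≠ 0 ∨ (w : ℕ) ≠ 0) →
    ¬ Passes a b c p ((u : ℕ) : ℤ) ((v : ℕ) : ℤ) ((w : ℕ) : ℤ)

/-- `NoNewIntegralAt` is decidable (a finite conjunction over `Fin p ³`); use `decide` for `p ≤ 7`. [folklore] -/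
instance (a b c : ℤ) (p : ℕ) : Decidable (NoNewIntegralAt a b c p) := by
  unfold NoNewIntegralAt; infer_instance

section Cubic

variable {K : Type*} [Field K] [NumberField K] {a b c : ℤ} {θ : K}

/-- The trace of an algebraic integer is a rational integer. [folklore] -/
theorem exists_int_trace (z : 𝓞 K) : ∃ t : ℤ, Algebra.trace ℚ K (z : K) = t := by
  have hz : IsIntegral ℤ (z : K) := z.2
  have h1 : IsIntegral ℤ (Algebra.trace ℚ K (z : K)) := Algebra.isIntegral_trace hz
  obtain ⟨t, ht⟩ := IsIntegrallyClosed.isIntegral_iff.mp h1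
  exact ⟨t, by rw [← ht, eq_intCast]⟩

/-- The norm of an algebraic integer is a rational integer. [folklore] -/
theorem exists_int_norm (z : 𝓞 K) : ∃ t : ℤ, Algebra.norm ℚ (z : K) = t := by
  have hz : IsIntegral ℤ (z : K) := z.2
  have h1 : IsIntegral ℤ (Algebra.norm ℚ (z : K)) := Algebra.isIntegral_norm ℚ hz
  obtain ⟨t, ht⟩ := IsIntegrallyClosed.isIntegral_iff.mp h1
  exact ⟨t, by rw [← ht, eq_intCast]⟩

/-- If `p · z = u + vθ + wθ²` with `z ∈ 𝓞 K` then `p ∣ Tr(u + vθ + wθ²)`. [cite: Marcus2018, Ch. 2, Thm. 4] -/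
theorem dvd_trZ (hirr : Irreducible (polyQ a b c)) (hθ : aeval θ (poly a b c) = 0)
    (h3 : finrank ℚ K = 3) {p : ℕ} (hp : p.Prime) (z : 𝓞 K) (u v w : ℤ)
    (hz : (p : K) * (z : K) = (u : K) + (v : K) * θ + (w : K) * θ ^ 2) :
    (p : ℤ) ∣ trZ a b u v w := by
  have hp0 : (p : ℚ) ≠ 0 := by exact_mod_cast hp.ne_zero
  have hzK : (z : K) = ((u / p : ℚ) : K) + ((v / p : ℚ) : K) * θ + ((w / p : ℚ) : K) * θ ^ 2 := by
    have hpK : (p : K) ≠ 0 := by exact_mod_cast hp.ne_zero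
    have : (z : K) = (p : K)⁻¹ * ((u : K) + (v : K) * θ + (w : K) * θ ^ 2) := by
      rw [← hz, ← mul_assoc, inv_mul_cancel₀ hpK, one_mul]
    rw [this]; push_cast
    field_simp
  obtain ⟨t, ht⟩ := exists_int_trace z
  rw [hzK, trace_lin hirr hθ h3] at ht
  have h' : (trZ a b u v w : ℚ) = (p : ℚ) * t := by
    have := ht; unfold trZ; push_cast; field_simp at this; linarith
  exact ⟨t, by exact_mod_cast h'⟩

/-- If `p · z = u + vθ + wθ²` with `z ∈ 𝓞 K` then `p³ ∣ N(u + vθ + wθ²)`. [cite: Marcus2018, Ch. 2, Thm. 4] -/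
theorem dvd_nmZ (hirr : Irreducible (polyQ a b c)) (hθ : aeval θ (poly a b c) = 0)
    (h3 : finrank ℚ K = 3) {p : ℕ} (hp : p.Prime) (z : 𝓞 K) (u v w : ℤ)
    (hz : (p : K) * (z : K) = (u : K) + (v : K) * θ + (w : K) * θ ^ 2) :
    (p : ℤ) ^ 3 ∣ nmZ a b c u v w := by
  have hp0 : (p : ℚ) ≠ 0 := by exact_mod_cast hp.ne_zero
  have hzK : (z : K) = ((u / p : ℚ) : K) + ((v / p : ℚ) : K) * θ + ((w / p : ℚ) : K) * θ ^ 2 := by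
    have hpK : (p : K) ≠ 0 := by exact_mod_cast hp.ne_zero
    have : (z : K) = (p : K)⁻¹ * ((u : K) + (v : K) * θ + (w : K) * θ ^ 2) := by
      rw [← hz, ← mul_assoc, inv_mul_cancel₀ hpK, one_mul]
    rw [this]; push_cast
    field_simp
  obtain ⟨t, ht⟩ := exists_int_norm z
  rw [hzK, norm_lin hirr hθ h3] at ht
  have h' : (nmZ a b c u v w : ℚ) = (p : ℚ) ^ 3 * t := by
    have := ht; unfold nmZ; unfold normForm at this; push_cast; field_simp at this; linarith
  exact ⟨t, by exact_mod_cast h'⟩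

/-- **The seven tests are necessary:** if `u + vθ + wθ² = p · y` with `y ∈ 𝓞 K` then
`Passes a b c p u v w`. [cite: Marcus2018, Ch. 2, Thm. 4] -/
theorem passes_of_eq_smul (hirr : Irreducible (polyQ a b c)) (hθ : aeval θ (poly a b c) = 0)
    (h3 : finrank ℚ K = 3) {p : ℕ} (hp : p.Prime) (y : 𝓞 K) (u v w : ℤ)
    (hy : (p : K) * (y : K) = (u : K) + (v : K) * θ + (w : K) * θ ^ 2) :
    Passes a b c p u v w := by
  have hrel := theta_rel hθ
  have hθy : (p : K) * ((thetaInt hθ * y : 𝓞 K) : K) =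
      ((-c * w : ℤ) : K) + ((u - b * w : ℤ) : K) * θ + ((v - a * w : ℤ) : K) * θ ^ 2 := by
    change (p : K) * (θ * (y : K)) = _
    have h' : (p : K) * (θ * (y : K)) = θ * ((p : K) * (y : K)) := by ring
    rw [h', hy]; push_cast; linear_combination (w : K) * hrel
  have hθθy : (p : K) * ((thetaInt hθ * (thetaInt hθ * y) : 𝓞 K) : K) =
      ((-c * (v - a * w) : ℤ) : K) + ((-c * w - b * (v - a * w) : ℤ) : K) * θ +
        (((u - b * w) - a * (v - a * w) : ℤ) : K) * θ ^ 2 := by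
    change (p : K) * (θ * (θ * (y : K))) = _
    change (p : K) * (θ * (y : K)) = _ at hθy
    have h' : (p : K) * (θ * (θ * (y : K))) = θ * ((p : K) * (θ * (y : K))) := by ring
    rw [h', hθy]; push_cast; linear_combination ((v : K) - a * w) * hrel
  have h1 : (p : K) * ((y + 1 : 𝓞 K) : K) = ((u + p : ℤ) : K) + (v : K) * θ + (w : K) * θ ^ 2 := by
    change (p : K) * ((y : K) + 1) = _
    rw [mul_add, hy]; push_cast; ring
  have h2 : (p : K) * ((y + 1 + 1 : 𝓞 K) : K) = ((u + 2 * p : ℤ) : K) + (v : K) * θ + (w : K) * θ ^ 2 := by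
    change (p : K) * ((y : K) + 1 + 1) = _
    rw [mul_add, mul_add, hy]; push_cast; ring
  have hθ1 : (p : K) * ((y + thetaInt hθ : 𝓞 K) : K) = (u : K) + ((v + p : ℤ) : K) * θ + (w : K) * θ ^ 2 := by
    change (p : K) * ((y : K) + θ) = _
    rw [mul_add, hy]; push_cast; ring
  exact ⟨dvd_trZ hirr hθ h3 hp y u v w hy, dvd_trZ hirr hθ h3 hp _ _ _ _ hθy,
    dvd_trZ hirr hθ h3 hp _ _ _ _ hθθy, dvd_nmZ hirr hθ h3 hp y u v w hy,
    dvd_nmZ hirr hθ h3 hp _ _ _ _ h1, dvd_nmZ hirr hθ h3 hp _ _ _ _ h2,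
    dvd_nmZ hirr hθ h3 hp _ _ _ _ hθ1⟩

/-- `Δ(g) = indexDet² · d_K` in `ℤ` for the power basis `1, θ, θ²`. [cite: Marcus2018, Ch. 2, Exercise 27(c)] -/
theorem disc_eq_indexDet_sq_mul_discr (hirr : Irreducible (polyQ a b c))
    (hθ : aeval θ (poly a b c) = 0) (h3 : finrank ℚ K = 3) :
    disc a b c = indexDet (pb hirr hθ h3) (isIntegral_pb_gen hirr hθ h3) ^ 2 * NumberField.discr K := by
  have h := discr_powerBasis_eq_indexDet_sq_mul_discr (pb hirr hθ h3) (isIntegral_pb_gen hirr hθ h3)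
  rw [discr_pb hirr hθ h3] at h
  exact_mod_cast h

/-- **Index `1` from the finite check.** If `Δ(g) = r² e` with `e` squarefree and no new
integral element exists at any prime `p ∣ r`, then `indexDet(1, θ, θ²) = ±1`.
[cite: Marcus2018, Ch. 2, Exercise 27] -/
theorem isUnit_indexDet_of_check (hirr : Irreducible (polyQ a b c))
    (hθ : aeval θ (poly a b c) = 0) (h3 : finrank ℚ K = 3) (r e : ℤ)
    (hdisc : disc a b c = r ^ 2 * e) (he : Squarefree e)
    (hchk : ∀ p : ℕ, p.Prime → (p : ℤ) ∣ r → NoNewIntegralAt a b c p) :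
    IsUnit (indexDet (pb hirr hθ h3) (isIntegral_pb_gen hirr hθ h3)) := by
  set D := indexDet (pb hirr hθ h3) (isIntegral_pb_gen hirr hθ h3) with hD
  by_contra hnu
  have hne : D.natAbs ≠ 1 := fun h => hnu (Int.isUnit_iff_natAbs_eq.mpr h)
  obtain ⟨p, hp, hpD⟩ := Nat.exists_prime_and_dvd hne
  have hpDz : (p : ℤ) ∣ D := Int.natCast_dvd.mpr hpD
  -- `p² ∣ Δ = r² e`, hence `p ∣ r` (as `e` is squarefree)
  have hpP : Prime (p : ℤ) := Nat.prime_iff_prime_int.mp hp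
  have hp2 : (p : ℤ) ^ 2 ∣ r ^ 2 * e := by
    rw [← hdisc, disc_eq_indexDet_sq_mul_discr hirr hθ h3]
    exact Dvd.dvd.mul_right (pow_dvd_pow_of_dvd hpDz 2) _
  have hpr : (p : ℤ) ∣ r := by
    by_contra hpr
    have hpr2 : ¬ (p : ℤ) ∣ r ^ 2 := fun h => hpr (hpP.dvd_of_dvd_pow h)
    have hpe : (p : ℤ) ∣ e := by
      rcases hpP.dvd_or_dvd (dvd_trans (dvd_pow_self (p : ℤ) two_ne_zero) hp2) with h | h
      · exact absurd h hpr2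
      · exact h
    obtain ⟨e', rfl⟩ := hpe
    have hpe' : (p : ℤ) ∣ e' := by
      have h' : (p : ℤ) * (p : ℤ) ∣ (p : ℤ) * (r ^ 2 * e') := by
        rw [← pow_two]; convert hp2 using 1; ring
      rcases hpP.dvd_or_dvd ((mul_dvd_mul_iff_left (by exact_mod_cast hp.ne_zero)).mp h') with h | h
      · exact absurd h hpr2
      · exact h
    obtain ⟨e'', rfl⟩ := hpe'
    have hu : IsUnit (p : ℤ) := he (p : ℤ) ⟨e'', by ring⟩
    exact hp.ne_one (by simpa [Int.isUnit_iff_natAbs_eq] using hu)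
  -- a kernel vector mod `p`: `u + vθ + wθ² = p · y`
  obtain ⟨cf, hlt, hne0, y, hy⟩ :=
    exists_smul_eq_of_prime_dvd_indexDet (pb hirr hθ h3) (isIntegral_pb_gen hirr hθ h3) hp hpDz
  have hdim := pb_dim hirr hθ h3
  -- transport the coefficients to `ℕ → ℕ` and the sum to `cf' 0 + cf' 1 θ + cf' 2 θ²`
  let cf' : ℕ → ℕ := fun n => if h : n < (pb hirr hθ h3).dim then cf ⟨n, h⟩ else 0
  have hcf' : ∀ j : Fin (pb hirr hθ h3).dim, cf j = cf' j := by
    intro j; simp [cf', j.2]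
  let f : ℕ → K := fun n => ((cf' n : ℕ) : K) * θ ^ n
  have hsumK : (((∑ j, ((cf j : ℕ) : ℤ) • powInt (pb hirr hθ h3) (isIntegral_pb_gen hirr hθ h3) j
      : 𝓞 K)) : K) = ∑ n ∈ Finset.range (pb hirr hθ h3).dim, f n := by
    rw [← Fin.sum_univ_eq_sum_range]
    change algebraMap (𝓞 K) K _ = _
    rw [map_sum]
    refine Finset.sum_congr rfl fun j _ => ?_
    rw [map_zsmul, zsmul_eq_mul, hcf' j]
    change _ * ((powInt (pb hirr hθ h3) (isIntegral_pb_gen hirr hθ h3) j : 𝓞 K) : K) = _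
    rw [coe_powInt, PowerBasis.coe_basis, pb_gen]
    push_cast
    rfl
  have hsum3 : (((∑ j, ((cf j : ℕ) : ℤ) • powInt (pb hirr hθ h3) (isIntegral_pb_gen hirr hθ h3) j
      : 𝓞 K)) : K) = ((cf' 0 : ℕ) : K) + ((cf' 1 : ℕ) : K) * θ + ((cf' 2 : ℕ) : K) * θ ^ 2 := by
    rw [hsumK, hdim]
    simp only [Finset.sum_range_succ, Finset.sum_range_zero, f, pow_zero, mul_one, pow_one,
      zero_add]
  have hyK : (p : K) * (y : K) = (((cf' 0 : ℕ) : ℤ) : K) + (((cf' 1 : ℕ) : ℤ) : K) * θ +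
      (((cf' 2 : ℕ) : ℤ) : K) * θ ^ 2 := by
    have h := congrArg (algebraMap (𝓞 K) K) hy
    rw [map_zsmul, zsmul_eq_mul] at h
    change (((∑ j, ((cf j : ℕ) : ℤ) • powInt (pb hirr hθ h3) (isIntegral_pb_gen hirr hθ h3) j
      : 𝓞 K)) : K) = _ * (y : K) at h
    rw [hsum3] at h
    push_cast at h ⊢
    linear_combination (-1 : K) * h
  have hpass := passes_of_eq_smul hirr hθ h3 hp y _ _ _ hyK
  have hlt' : ∀ n, cf' n < p := by
    intro n; simp only [cf']; split_ifs with h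
    · exact hlt _
    · exact hp.pos
  obtain ⟨j, hj⟩ := hne0
  have hj' : cf' j ≠ 0 := by rw [← hcf' j]; exact hj
  have hjlt : (j : ℕ) < 3 := hdim ▸ j.2
  refine hchk p hp hpr ⟨cf' 0, hlt' 0⟩ ⟨cf' 1, hlt' 1⟩ ⟨cf' 2, hlt' 2⟩ ?_ hpass
  simp only [ne_eq]
  interval_cases hj : (j : ℕ)
  · exact Or.inl hj'
  · exact Or.inr (Or.inl hj')
  · exact Or.inr (Or.inr hj')

/-- **`𝓞 K = ℤ[θ]` (`exponent = 1`) from the finite check.** [cite: Marcus2018, Ch. 2, Exercise 27] -/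
theorem exponent_thetaInt_eq_one_of_check (hirr : Irreducible (polyQ a b c))
    (hθ : aeval θ (poly a b c) = 0) (h3 : finrank ℚ K = 3) (r e : ℤ)
    (hdisc : disc a b c = r ^ 2 * e) (he : Squarefree e)
    (hchk : ∀ p : ℕ, p.Prime → (p : ℤ) ∣ r → NoNewIntegralAt a b c p) :
    RingOfIntegers.exponent (thetaInt hθ) = 1 := by
  refine RingOfIntegers.exponent_eq_one_iff.mpr (Algebra.eq_top_iff.mpr fun x => ?_)
  have hx := mem_adjoin_of_isUnit_indexDet (pb hirr hθ h3) (isIntegral_pb_gen hirr hθ h3)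
    (isUnit_indexDet_of_check hirr hθ h3 r e hdisc he hchk) x
  rw [pb_gen] at hx
  rw [Algebra.adjoin_singleton_eq_range_aeval] at hx ⊢
  obtain ⟨g, hg⟩ := hx
  refine ⟨g, ?_⟩
  apply IsFractionRing.injective (𝓞 K) K
  change algebraMap (𝓞 K) K (aeval (thetaInt hθ) g) = (x : K)
  rw [← aeval_algebraMap_apply]
  exact hg

/-- **`d_K = Δ(g)`** from the finite check. [cite: Marcus2018, Ch. 2, Exercise 27] -/
theorem discr_eq_disc_of_check (hirr : Irreducible (polyQ a b c))
    (hθ : aeval θ (poly a b c) = 0) (h3 : finrank ℚ K = 3) (r e : ℤ)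
    (hdisc : disc a b c = r ^ 2 * e) (he : Squarefree e)
    (hchk : ∀ p : ℕ, p.Prime → (p : ℤ) ∣ r → NoNewIntegralAt a b c p) :
    NumberField.discr K = disc a b c :=
  discr_eq_of_isUnit_indexDet (pb hirr hθ h3) (isIntegral_pb_gen hirr hθ h3)
    (isUnit_indexDet_of_check hirr hθ h3 r e hdisc he hchk) (disc a b c) (discr_pb hirr hθ h3)

end Cubic

/-! ### Discharging `∀ p prime, p ∣ r → …` for an explicit `r`

Per field, `r` is a small explicit product of prime powers; the generated files peel it with
`(Nat.prime_iff_prime_int.mp hp).dvd_mul` and identify `p` from `(p : ℤ) ∣ q ^ k` by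
`(Nat.prime_dvd_prime_iff_eq hp hq).mp (Int.natCast_dvd_natCast.mp (….dvd_of_dvd_pow h))`
(no helper lemmas here: the tree's `Literature.NumberTheory.EllipticCurves.DeuringModels.eq_of_prime_dvd_prime_pow`
is the same statement), then `decide`. -/

/-! ### Sanity checks (the field `x³ + x² - 4x - 6`, `Δ = -244 = 2²·(-61)`, index `1`) -/

example : NoNewIntegralAt 1 (-4) (-6) 2 := by decide

example : ¬ NoNewIntegralAt 0 0 (-8) 2 := by decide   -- `x³ - 8`: `θ = 2`, reducible toy (θ²/2 passes)

end Summit.BirchSwinnertonDyer.BirchSwinnertonDyer.Rank2Observatory.CubicIndexCheck
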